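import Summits.NavierStokesRegularity.NavierStokesRegularity.Theorems.RecurrentProfilesRecurrentLiouvillePrAuslanderEllis
import Summits.NavierStokesRegularity.NavierStokesRegularity.Theorems.RecurrentProfilesRecurrentLiouvillePrTwoSidedRecurrence
import Mathlib.Topology.Metrizable.Uniformity
import Mathlib.Topology.MetricSpace.Basic
import Mathlib.Topology.Sequences
import HarnessLib

/-!
# Crux `RecurrentLiouville` (stmt-NavierStokesRegularity-1589), line `Sketch` v9 — tools for stub H3:
# a uniformly recurrent point PROXIMAL ALONG BACKWARD STEPS in a compact invariant set of a
# pseudo-metrisable `ℝ`-flow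

Theorems-only `--supports` helper (lead c11) for `stub_prProximalReduction`
(`Theorems/RecurrentProfilesRecurrentLiouvillePrProximalReduction.lean`).  The abstract dynamics of
the proximal recurrent reduction, separated from the Navier–Stokes bookkeeping:

* `stub_prProximalTools` (registered tools stub of the skeleton) — let `ℝ` act on a PSEUDO-METRISABLE space `X` by
  continuous maps with the action law and `ϕ 0 = id`, and let `S` be a compact invariant set
  containing `x₀`.  Then some `y ∈ S` is UNIFORMLY RECURRENT for the flow and is reached from `x₀`
  along BACKWARD unit steps: either `x₀` and `y` are topologically indistinguishable, or there are
  steps `mₖ → ∞` and a point `z ∈ S` with `ϕ(−mₖ) x₀ → z` and `ϕ(−mₖ) y → z`.  Proof: pass to the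
  separation quotient of `S` (compact metric), apply the Auslander–Ellis theorem
  (`stub_prAuslanderEllis`, p161054) to the backward unit-step action, upgrade to two-sided
  recurrence (`stub_prTwoSidedRecurrence`, p160858), lift along the inducing quotient map, and
  extract a sequence of steps realising the proximality (bounded steps collapse the two classes).
* `prPR_exists_subseq_tendsto_atTop`, `prPR_exists_frequently_eq` — extraction lemmas for
  sequences of naturals.

## References

* J. Auslander, Proc. AMS 11 (1960) 890–895; R. Ellis, Trans. AMS 94 (1960) 272–281;
  H. Furstenberg, *Recurrence in Ergodic Theory and Combinatorial Number Theory* (1981), Ch. 8,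
  Thm. 8.7. [Furstenberg1981]
-/

noncomputable section

-- the sub-problem namespace repeats the summit name (D-0017 layout `Summit.<S>.<P>.Theorems`)
set_option linter.dupNamespace false

namespace Summit.NavierStokesRegularity.NavierStokesRegularity.Theorems

open Set Function Filter Topology TopologicalSpace
open Literature.Dynamics.TopologicalDynamics

/-! ### Two extraction lemmas for sequences of natural numbers -/

/-- An unbounded sequence of naturals has a subsequence tending to infinity along a strictly
increasing reindexing. [folklore] -/
theorem prPR_exists_subseq_tendsto_atTop {m : ℕ → ℕ} (hm : ¬ BddAbove (range m)) :
    ∃ κ : ℕ → ℕ, StrictMono κ ∧ Tendsto (m ∘ κ) atTop atTop := by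
  have hfreq : ∀ N : ℕ, ∃ᶠ k in atTop, N ≤ m k := by
    intro N
    rw [frequently_atTop]
    intro K₀
    by_contra h
    push Not at h
    apply hm
    refine ⟨max N (Finset.sup (Finset.range K₀) m), ?_⟩
    rintro _ ⟨k, rfl⟩
    by_cases hk : k < K₀
    · exact le_max_of_le_right (Finset.le_sup (Finset.mem_range.2 hk))
    · exact le_max_of_le_left (h k (not_lt.1 hk)).le
  obtain ⟨κ, hκ, hκN⟩ := extraction_forall_of_frequently hfreq
  refine ⟨κ, hκ, tendsto_atTop_mono hκN tendsto_id⟩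

/-- A bounded sequence of naturals takes some value frequently. [folklore] -/
theorem prPR_exists_frequently_eq {m : ℕ → ℕ} (hm : BddAbove (range m)) :
    ∃ v : ℕ, ∃ᶠ k in atTop, m k = v := by
  obtain ⟨N, hN⟩ := hm
  by_contra h
  push Not at h
  have hev : ∀ v ∈ Finset.range (N + 1), ∀ᶠ k in atTop, m k ≠ v := fun v _ => by
    simpa only [not_frequently] using h v
  have hall : ∀ᶠ k in atTop, ∀ v ∈ Finset.range (N + 1), m k ≠ v :=
    (Finset.eventually_all (Finset.range (N + 1))).2 hev
  obtain ⟨k, hk⟩ := hall.exists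
  exact hk (m k) (Finset.mem_range.2 (Nat.lt_succ_of_le (hN ⟨k, rfl⟩))) rfl

/-! ### A uniformly recurrent point proximal along backward steps -/

/-- **A uniformly recurrent point reached along backward unit steps.**  Let `ℝ` act on a
pseudo-metrisable space `X` by continuous maps with `ϕ (s + t) = ϕ s ∘ ϕ t` and `ϕ 0 = id`, and let
`S` be a compact invariant set with `x₀ ∈ S`.  Then there is `y ∈ S`, UNIFORMLY RECURRENT for the
flow (return times to every neighbourhood relatively dense in `ℝ`), such that EITHER `x₀` and `y`
are topologically indistinguishable, OR for some steps `mₖ → ∞` and some `z ∈ S` both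
`ϕ(−mₖ) x₀ → z` and `ϕ(−mₖ) y → z` (proximality along the backward steps).  Proof: separation
quotient of `S` (compact metric), Auslander–Ellis for the backward unit-step action
(`stub_prAuslanderEllis`), two-sidedness (`stub_prTwoSidedRecurrence`), lift along the inducing map
`SeparationQuotient.mk`, sequence extraction in the metrisable `Y × Y`; bounded steps force the two
classes to coincide. [cite: Furstenberg1981, Ch. 8, Thm. 8.7] -/
theorem stub_prProximalTools {X : Type*} [TopologicalSpace X]
    [PseudoMetrizableSpace X] {ϕ : ℝ → X → X} (hcont : ∀ t, Continuous (ϕ t))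
    (hadd : ∀ s t x, ϕ (s + t) x = ϕ s (ϕ t x)) (h0 : ∀ x, ϕ 0 x = x)
    {S : Set X} (hS : IsCompact S) (hinv : ∀ t, MapsTo (ϕ t) S S) {x₀ : X} (hx₀ : x₀ ∈ S) :
    ∃ y ∈ S, IsUniformlyRecurrentPt ϕ y ∧
      (Inseparable x₀ y ∨
        ∃ (m : ℕ → ℕ) (z : X), z ∈ S ∧ Tendsto m atTop atTop ∧
          Tendsto (fun k => ϕ (-(m k : ℝ)) x₀) atTop (𝓝 z) ∧
          Tendsto (fun k => ϕ (-(m k : ℝ)) y) atTop (𝓝 z)) := by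
  classical
  -- ## the compact subsystem `S` and its Hausdorff (separation) quotient `Y`
  haveI hScs : CompactSpace S := isCompact_iff_compactSpace.1 hS
  let ϕS : ℝ → S → S := fun t s => ⟨ϕ t s.1, hinv t s.2⟩
  have hcontS : ∀ t, Continuous (ϕS t) := fun t =>
    ((hcont t).comp continuous_subtype_val).subtype_mk _
  have haddS : ∀ s t (x : S), ϕS (s + t) x = ϕS s (ϕS t x) := fun s t x =>
    Subtype.ext (hadd s t x.1)
  have h0S : ∀ x : S, ϕS 0 x = x := fun x => Subtype.ext (h0 x.1)
  letI mS : PseudoMetricSpace S := TopologicalSpace.pseudoMetrizableSpacePseudoMetric S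
  let Y := SeparationQuotient S
  haveI hYc : CompactSpace Y := Quotient.compactSpace
  let ϕY : ℝ → Y → Y := fun t =>
    SeparationQuotient.lift (SeparationQuotient.mk ∘ ϕS t)
      (fun a b h => SeparationQuotient.mk_eq_mk.2 (h.map (hcontS t)))
  have hϕY_mk : ∀ t (s : S), ϕY t (SeparationQuotient.mk s) = SeparationQuotient.mk (ϕS t s) :=
    fun t s => SeparationQuotient.lift_mk _ s
  have hcontY : ∀ t, Continuous (ϕY t) := fun t =>
    SeparationQuotient.continuous_lift_iff.2 (SeparationQuotient.continuous_mk.comp (hcontS t))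
  have haddY : ∀ s t (q : Y), ϕY (s + t) q = ϕY s (ϕY t q) := by
    intro s t q
    obtain ⟨a, rfl⟩ := SeparationQuotient.surjective_mk q
    rw [hϕY_mk, hϕY_mk, hϕY_mk, haddS]
  have h0Y : ∀ q : Y, ϕY 0 q = q := by
    intro q
    obtain ⟨a, rfl⟩ := SeparationQuotient.surjective_mk q
    rw [hϕY_mk, h0S]
  -- the backward unit-step action on `Y`
  let ψY : ℕ → Y → Y := fun (n : ℕ) (x : Y) => ϕY (-(n : ℝ)) x
  have hcontψ : ∀ n, Continuous (ψY n) := fun n => hcontY _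
  have haddψ : ∀ m n (q : Y), ψY (m + n) q = ψY m (ψY n q) := by
    intro m n q
    show ϕY (-((m + n : ℕ) : ℝ)) q = ϕY (-(m : ℝ)) (ϕY (-(n : ℝ)) q)
    rw [Nat.cast_add, neg_add, haddY]
  -- ## Auslander–Ellis for the backward steps, and two-sidedness
  let x₀S : S := ⟨x₀, hx₀⟩
  obtain ⟨yY, -, hrecψ, zY, hzY⟩ :=
    stub_prAuslanderEllis (G := ℕ) (X := Y) hcontψ haddψ (SeparationQuotient.mk x₀S)
  have hrecY : IsUniformlyRecurrentPt ϕY yY :=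
    stub_prTwoSidedRecurrence (X := Y) hcontY haddY h0Y hrecψ
  -- ## lift to `S`, transfer the recurrence to `S` (`mk` is inducing) and to `X`
  obtain ⟨y, rfl⟩ := SeparationQuotient.surjective_mk yY
  have hrecSy : IsUniformlyRecurrentPt ϕS y := by
    intro U hU
    rw [← SeparationQuotient.comap_mk_nhds_mk, mem_comap] at hU
    obtain ⟨V, hV, hVU⟩ := hU
    refine (hrecY V hV).mono fun t ht => hVU ?_
    show SeparationQuotient.mk (ϕS t y) ∈ V
    rw [← hϕY_mk]
    exact ht
  have hrecX : IsUniformlyRecurrentPt ϕ (y : X) := by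
    intro U hU
    have hU' : Subtype.val ⁻¹' U ∈ 𝓝 y := continuous_subtype_val.continuousAt.preimage_mem_nhds hU
    exact (hrecSy _ hU').mono fun t ht => ht
  -- ## the proximal sequence of backward steps
  obtain ⟨zS, rfl⟩ := SeparationQuotient.surjective_mk zY
  obtain ⟨pr, hpr, hprlim⟩ := mem_closure_iff_seq_limit.1 hzY
  choose m hm using hpr
  have hpair : ∀ k, pr k = (SeparationQuotient.mk (ϕS (-(m k : ℝ)) x₀S),
      SeparationQuotient.mk (ϕS (-(m k : ℝ)) y)) := by
    intro k
    rw [← hm k]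
    show (ϕY (-(m k : ℝ)) (SeparationQuotient.mk x₀S), ϕY (-(m k : ℝ)) (SeparationQuotient.mk y)) = _
    rw [hϕY_mk, hϕY_mk]
  -- convergence of `mk`-images of points of `S` is convergence in `X`
  have hmk_tendsto : ∀ (a : ℕ → S) (c : S),
      Tendsto (fun k => SeparationQuotient.mk (a k)) atTop (𝓝 (SeparationQuotient.mk c)) →
      Tendsto (fun k => ((a k : S) : X)) atTop (𝓝 (c : X)) := by
    intro a c h
    have h1 : Tendsto a atTop (𝓝 c) := by
      rwa [SeparationQuotient.isInducing_mk.tendsto_nhds_iff]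
    exact (continuous_subtype_val.tendsto c).comp h1
  refine ⟨y, y.2, hrecX, ?_⟩
  by_cases hB : BddAbove (range m)
  · -- ### bounded steps: the classes of `x₀` and `y` coincide
    left
    obtain ⟨v, hv⟩ := prPR_exists_frequently_eq hB
    have hconst : (SeparationQuotient.mk (ϕS (-(v : ℝ)) x₀S), SeparationQuotient.mk (ϕS (-(v : ℝ)) y)) =
        (SeparationQuotient.mk zS, SeparationQuotient.mk zS) := by
      obtain ⟨κ, hκ, hκv⟩ := extraction_of_frequently_atTop hv
      have h1 : Tendsto (pr ∘ κ) atTop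
          (𝓝 (SeparationQuotient.mk zS, SeparationQuotient.mk zS)) :=
        hprlim.comp hκ.tendsto_atTop
      have h2 : pr ∘ κ = fun _ => (SeparationQuotient.mk (ϕS (-(v : ℝ)) x₀S),
          SeparationQuotient.mk (ϕS (-(v : ℝ)) y)) := by
        funext k
        show pr (κ k) = _
        rw [hpair, hκv k]
      rw [h2] at h1
      exact tendsto_nhds_unique tendsto_const_nhds h1
    have heq : SeparationQuotient.mk x₀S = SeparationQuotient.mk y := by
      have h1 : SeparationQuotient.mk (ϕS (-(v : ℝ)) x₀S) = SeparationQuotient.mk (ϕS (-(v : ℝ)) y) :=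
        (Prod.mk.inj hconst).1.trans (Prod.mk.inj hconst).2.symm
      have h2 : ∀ s : S, ϕY (v : ℝ) (SeparationQuotient.mk (ϕS (-(v : ℝ)) s)) =
          SeparationQuotient.mk s := by
        intro s
        rw [hϕY_mk, ← haddS, add_neg_cancel, h0S]
      rw [← h2 x₀S, ← h2 y, h1]
    have hins : Inseparable x₀S y := SeparationQuotient.mk_eq_mk.1 heq
    exact hins.map continuous_subtype_val
  · -- ### unbounded steps: a subsequence `m (κ k) → ∞` with a common limit `zS`
    right
    obtain ⟨κ, hκ, hmκ⟩ := prPR_exists_subseq_tendsto_atTop hB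
    have hlim : Tendsto (pr ∘ κ) atTop (𝓝 (SeparationQuotient.mk zS, SeparationQuotient.mk zS)) :=
      hprlim.comp hκ.tendsto_atTop
    have hfst : Tendsto (fun k => SeparationQuotient.mk (ϕS (-(m (κ k) : ℝ)) x₀S)) atTop
        (𝓝 (SeparationQuotient.mk zS)) := by
      have h := (continuous_fst.tendsto _).comp hlim
      refine h.congr fun k => ?_
      show (pr (κ k)).1 = _
      rw [hpair]
    have hsnd : Tendsto (fun k => SeparationQuotient.mk (ϕS (-(m (κ k) : ℝ)) y)) atTop
        (𝓝 (SeparationQuotient.mk zS)) := by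
      have h := (continuous_snd.tendsto _).comp hlim
      refine h.congr fun k => ?_
      show (pr (κ k)).2 = _
      rw [hpair]
    exact ⟨m ∘ κ, zS, zS.2, hmκ, hmk_tendsto _ _ hfst, hmk_tendsto _ _ hsnd⟩

end Summit.NavierStokesRegularity.NavierStokesRegularity.Theorems

end
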